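import Summits.CriticalPhenomena.Ising3D.Control2DParity
import Summits.CriticalPhenomena.Ising3D.Control2DRecordIsing
import Mathlib.Tactic.Linarith
import Mathlib.Tactic.NormNum
import Mathlib.Tactic.Ring
import HarnessLib

/-!
# Parity symmetry is bookkeeping, part 2: the 2D record read without the parity convention, and the oriented
# Ising witness (cell `pub-ising3x`, seat controls-1 gen 41; PAPER §6.2 / Appendix E — CONTROL-ONLY)

HONEST FRAMING: lottery ticket; floor = tightest certified 3D Ising CFT bounds; no exact-solution
claim without a proof. CONTROL-ONLY (`d = 2`, `Δ_σ = 1/8` an INPUT, axiom set `A2D′`); nothing here is about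
`d = 3`, no certificate, functional or number of the record is touched, no new hypothesis or named fact enters.

`Control2DParity` proves that every typed 2D statement transfers to ORIENTED data (independent left/right weights,
no parity symmetry) through the symmetrisation `D.symm`. This file

* instantiates the transfer at the kernel record of `Control2DRecord`: `oriented_gapExcluded_L19` (no oriented
  unitary solution at `Δ_σ = 1/8` has all scalars at `Δ ≥ 1.00005`), `oriented_twoSided_kernel099` and
  **`oriented_controlDataSet_kernel099 (w)`** — every parity-UNCONSTRAINED unitary solution of the `Δ_σ = 1/8` sum
  rule with scalars in `{x} ∪ [2, ∞)`, spin 2 in `{2} ∪ [3, ∞)`, `w ≤ x`, has `0.99 < x < 1.00005`, Ward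
  harmonic-mean central charge `2c_Lc_R/(c_L+c_R) ∈ (78125/156258, 125/248)` and oriented in-box total
  `λ² ∈ (0.247348, 0.25525)` (the `Λ = 19 / 15` record, by instantiation at `D.symm`);
* gives the converse reading `CrossingData.double : OrientedData` (labels `ι ⊕ ι`, both orientations, the full
  coefficient `p` on each) and proves it solves the ORIENTED sum rule GIVEN convergence of `Σ p g` on the open
  square (`double_satisfiesCrossing`): one orientation of a convergent unitary expansion is summable against `F_-`
  because `|F_-[b]| ≤ v^s b(z,z̄) + u^s b(1-z,1-z̄) ≤ v^s g(z,z̄) + u^s g(1-z,1-z̄)` termwise — the convergence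
  hypothesis is genuinely needed to split a pair into its orientations, and the typed sum rule alone does not
  supply it;
* pins the normalisation (lead review ask): `double_stressCoeff` / `double_boxCoeff` — the oriented totals of the
  doubling are TWICE the typed ones (`T ⊕ T̄` entered once ↦ `T` and `T̄`; typed scalar block `2 k k̄` ↦ two copies
  of `k k̄`), and `double_symm_stressCoeff` / `double_symm_boxCoeff` — symmetrising the doubling returns the typed
  totals; on the Ising datum: oriented `1/32 = p_T + p_T̄`, `1/4 = λ²_{σσε}`, symmetrised `1/64`, `1/8`
  (`isingOriented_totals`);
* discharges that hypothesis for the 2D Ising datum (`hasSum_isingData2D_blocks`), so the ORIENTED `A2D′` class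
  at `Δ_σ = 1/8` is inhabited — by ⟨σσσσ⟩ of the 2D Ising CFT read with `T` and `T̄` as two labels of coefficient
  `1/64 = (1/8)²/(2·½)` each (`isingOriented_stressLabels`) — and the location `x = 1` is admissible
  (`oriented_class_nonvacuous_eighth`).

NOT claimed: anything about Virasoro symmetry, anything three-dimensional, any new bound, uniqueness.

References: R. Rattazzi, V. S. Rychkov, E. Tonni, A. Vichi, JHEP 12 (2008) 031, §3 eq. (3.6), §5
[cite: RattazziEtAl2008, §5]; A. A. Belavin, A. M. Polyakov, A. B. Zamolodchikov, Nucl. Phys. B 241 (1984) 333, §3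
and App. E [cite: BelavinPolyakovZamolodchikov1984, §3]. Tree: `OrientedData`, `orientedBlock`, the `.oriented`
transfer lemmas (`Control2DParity`); `gapExcluded_2d_L19_gapC`, `twoSided_2d_kernel099`, `controlDataSet_kernel099`
(`Control2DRecord` closure); `isingData2D`, `hasSum_isingData2D_blocks`, `isingData2D_isUnitary/_satisfiesCrossing/
_scalarsIn/_spinTwoIn/_stressLabel` (`Control2DIsingData/Spectrum`). Mathlib: `Summable.of_norm_bounded`,
`HasSum.add/.congr_fun/.unique/.sum`, `abs_sub`.
-/

namespace Summit.CriticalPhenomena.Ising3D.Control2D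

open Set
open Literature.MathematicalPhysics.QuantumFieldTheory.ConformalBootstrap3D

/-! ### The record, re-read without parity symmetry (instantiation at `Δ_σ = 1/8`) -/

/-- **One-sided item of record, oriented**: no parity-unconstrained unitary solution of the `Δ_σ = 1/8` sum rule
has all its scalars at `Δ ≥ 20001/20000` (`Λ = 19`, `E₀ = 48`: `gapExcluded_2d_L19_gapC` at the symmetrisation).
[cite: RattazziEtAl2008, §5] -/
theorem oriented_gapExcluded_L19 (D : OrientedData) (hU : D.IsUnitary) (hC : D.SatisfiesCrossing (1 / 8)) :
    ¬ D.toCrossingData.HasScalarGap (20001 / 20000) :=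
  gapExcluded_2d_L19_gapC.oriented D hU hC

/-- **Class-1 item of record, oriented**: every parity-unconstrained unitary `A2D′` solution at `Δ_σ = 1/8` with
its sub-gap scalars at one location `x ≥ w` has `99/100 < x < 20001/20000` (`twoSided_2d_kernel099`), every `w`.
[cite: RattazziEtAl2008, §5] -/
theorem oriented_twoSided_kernel099 (w : ℝ) (D : OrientedData) (hU : D.IsUnitary)
    (hC : D.SatisfiesCrossing (1 / 8)) (hT : D.toCrossingData.SpinTwoIn ({2} ∪ Ici (2 + 1))) (x : ℝ)
    (hwx : w ≤ x) (hS : D.toCrossingData.ScalarsIn ({x} ∪ Ici 2)) :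
    (99 / 100 : ℝ) < x ∧ x < 20001 / 20000 :=
  (twoSided_2d_kernel099 w).oriented D hU hC hT x hwx hS

/-- **The 2D data set of record holds WITHOUT the parity-symmetry convention**: for every window `w`, every
parity-unconstrained unitary solution of the `Δ_σ = 1/8` sum rule with spin 2 in `{2} ∪ [3, ∞)` and scalars in
`{x} ∪ [2, ∞)`, `w ≤ x`, has `99/100 < x < 20001/20000`; if its oriented total `(2,2)` coefficient is the Ward
value `(1/8)²/(2c_L) + (1/8)²/(2c_R)` (`c_L, c_R > 0`) then `78125/156258 < 2c_Lc_R/(c_L+c_R) < 125/248`; and its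
oriented in-box total (`= λ²_{σσ[box]}`) lies in `(2·123674/10⁶, 2·127625/10⁶) = (0.247348, 0.25525)`. The
`Λ = 19 / 15` kernel record `controlDataSet_kernel099` instantiated at the symmetrisation. CONTROL-ONLY.
[cite: RattazziEtAl2008, §5] -/
theorem oriented_controlDataSet_kernel099 (w : ℝ) (D : OrientedData) (hU : D.IsUnitary)
    (hC : D.SatisfiesCrossing (1 / 8)) (hT : D.toCrossingData.SpinTwoIn ({2} ∪ Ici (2 + 1))) (x : ℝ)
    (hwx : w ≤ x) (hS : D.toCrossingData.ScalarsIn ({x} ∪ Ici 2)) :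
    ((99 / 100 : ℝ) < x ∧ x < 20001 / 20000) ∧
      (∀ cL cR : ℝ, 0 < cL → 0 < cR →
        D.toCrossingData.stressCoeff = (1 / 8 : ℝ) ^ 2 / (2 * cL) + (1 / 8 : ℝ) ^ 2 / (2 * cR) →
          (78125 / 156258 : ℝ) < 2 * cL * cR / (cL + cR) ∧ 2 * cL * cR / (cL + cR) < 125 / 248) ∧
      (2 * (123674 / 1000000 : ℝ) < D.toCrossingData.boxCoeff (99 / 100) (20001 / 20000) ∧
        D.toCrossingData.boxCoeff (99 / 100) (20001 / 20000) < 2 * (127625 / 1000000 : ℝ)) :=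
  (controlDataSet_kernel099 w).oriented D hU hC hT x hwx hS

/-! ### The converse reading: typed data as oriented data -/

namespace CrossingData

variable {D : CrossingData} {s : ℝ}

/-- **Doubling**: the oriented datum listing each typed label in BOTH orientations (`Sum.inl` ↦ `true`,
`Sum.inr` ↦ `false`) with its full coefficient `p` on each — the block data `Σ p (k k̄ + k̄ k)` read as an
oriented expansion. [cite: RattazziEtAl2008, §3 eq. (3.6)] -/
def double (D : CrossingData) : OrientedData where
  ι := D.ι ⊕ D.ι
  Δ := Sum.elim D.Δ D.Δ
  spin := Sum.elim D.spin D.spin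
  p := Sum.elim D.p D.p
  orient := Sum.elim (fun _ => true) (fun _ => false)

/-- Unitarity of the doubling. [folklore] -/
theorem double_isUnitary (h : D.IsUnitary) : D.double.IsUnitary := by
  rintro (i | i) <;> exact h i

/-- Scalar and spin-2 contents of the doubling are those of `D`. [folklore] -/
theorem double_clauses {S T : Set ℝ} (hS : D.ScalarsIn S) (hT : D.SpinTwoIn T) :
    D.double.toCrossingData.ScalarsIn S ∧ D.double.toCrossingData.SpinTwoIn T := by
  constructor
  · rintro (i | i) hi <;> exact hS i hi
  · rintro (i | i) hi <;> exact hT i hi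

/-- The `(2,2)`-indicator of the doubling, on either copy of a label, is that of `D` (same `(Δ, ℓ)`, full `p`).
[folklore] -/
theorem double_stress_indicator (i : D.ι) :
    D.double.toCrossingData.stressSet.indicator D.double.p (Sum.inl i) = D.stressSet.indicator D.p i ∧
      D.double.toCrossingData.stressSet.indicator D.double.p (Sum.inr i) = D.stressSet.indicator D.p i := by
  unfold Set.indicator
  constructor
  · split_ifs with h1 h2 h2
    · rfl
    · exact (h2 h1).elim
    · exact (h1 h2).elim
    · rfl
  · split_ifs with h1 h2 h2
    · rfl
    · exact (h2 h1).elim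
    · exact (h1 h2).elim
    · rfl

/-- **The oriented total `(2,2)` coefficient of the doubling is TWICE the typed one** (`T ⊕ T̄` entered once with
`p_T` in the typed record ↦ a `T` label and a `T̄` label with `p_T` each), for data whose typed `(2,2)`-indicator is
summable (always the case with finitely many `(2,2)` labels). [folklore] -/
theorem double_stressCoeff (h : Summable (D.stressSet.indicator D.p)) :
    D.double.toCrossingData.stressCoeff = 2 * D.stressCoeff := by
  have A : HasSum ((D.double.toCrossingData.stressSet.indicator D.double.p) ∘ Sum.inl) D.stressCoeff :=
    h.hasSum.congr_fun fun i => (double_stress_indicator i).1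
  have B : HasSum ((D.double.toCrossingData.stressSet.indicator D.double.p) ∘ Sum.inr) D.stressCoeff :=
    h.hasSum.congr_fun fun i => (double_stress_indicator i).2
  calc D.double.toCrossingData.stressCoeff = D.stressCoeff + D.stressCoeff := (HasSum.sum A B).tsum_eq
    _ = 2 * D.stressCoeff := by ring

/-- **Symmetrising the doubling returns the typed total `(2,2)` coefficient** (`½ · 2 p_T = p_T`): the
conventions «`p/2` under `symm`» and «typed `(2,2)` label = `T ⊕ T̄` entered once» are one convention. [folklore] -/
theorem double_symm_stressCoeff (h : Summable (D.stressSet.indicator D.p)) :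
    D.double.symm.stressCoeff = D.stressCoeff := by
  rw [OrientedData.symm_stressCoeff, double_stressCoeff h]; ring

/-- The in-box indicator of the doubling, on either copy of a label, is that of `D`. [folklore] -/
theorem double_box_indicator (e₁ e₂ : ℝ) (i : D.ι) :
    (D.double.toCrossingData.boxSet e₁ e₂).indicator D.double.p (Sum.inl i) = (D.boxSet e₁ e₂).indicator D.p i ∧
      (D.double.toCrossingData.boxSet e₁ e₂).indicator D.double.p (Sum.inr i) = (D.boxSet e₁ e₂).indicator D.p i := by
  unfold Set.indicator
  constructor
  · split_ifs with h1 h2 h2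
    · rfl
    · exact (h2 h1).elim
    · exact (h1 h2).elim
    · rfl
  · split_ifs with h1 h2 h2
    · rfl
    · exact (h2 h1).elim
    · exact (h1 h2).elim
    · rfl

/-- **The oriented in-box total of the doubling is TWICE the typed `p_box`** — i.e. it is `λ²_{σσ[box]}` in the
standard normalisation (E.1's «`λ² = 2 p_box`»), for data whose typed in-box indicator is summable. [folklore] -/
theorem double_boxCoeff {e₁ e₂ : ℝ} (h : Summable ((D.boxSet e₁ e₂).indicator D.p)) :
    D.double.toCrossingData.boxCoeff e₁ e₂ = 2 * D.boxCoeff e₁ e₂ := by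
  have A : HasSum (((D.double.toCrossingData.boxSet e₁ e₂).indicator D.double.p) ∘ Sum.inl) (D.boxCoeff e₁ e₂) :=
    h.hasSum.congr_fun fun i => (double_box_indicator e₁ e₂ i).1
  have B : HasSum (((D.double.toCrossingData.boxSet e₁ e₂).indicator D.double.p) ∘ Sum.inr) (D.boxCoeff e₁ e₂) :=
    h.hasSum.congr_fun fun i => (double_box_indicator e₁ e₂ i).2
  calc D.double.toCrossingData.boxCoeff e₁ e₂ = D.boxCoeff e₁ e₂ + D.boxCoeff e₁ e₂ := (HasSum.sum A B).tsum_eq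
    _ = 2 * D.boxCoeff e₁ e₂ := by ring

/-- **Symmetrising the doubling returns the typed `p_box`.** [folklore] -/
theorem double_symm_boxCoeff {e₁ e₂ : ℝ} (h : Summable ((D.boxSet e₁ e₂).indicator D.p)) :
    D.double.symm.boxCoeff e₁ e₂ = D.boxCoeff e₁ e₂ := by
  rw [OrientedData.symm_boxCoeff, double_boxCoeff h]; ring

/-- **One orientation of a convergent unitary expansion is summable against `F_-`.** If `Σ p g` converges at
`(z, z̄)` and at `(1-z, 1-z̄)`, then for either orientation `o` the family `p_i F_-[b_{i,o}](z, z̄)` is summable: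
`|F_-[b]| ≤ v^s b(z,z̄) + u^s b(1-z,1-z̄) ≤ v^s g(z,z̄) + u^s g(1-z,1-z̄)` termwise (`0 ≤ b ≤ g`). [folklore] -/
theorem summable_oriented_of_convergent (hU : D.IsUnitary) {z zb : ℝ} (hz : z ∈ Ioo (0 : ℝ) 1)
    (hzb : zb ∈ Ioo (0 : ℝ) 1)
    (h₁ : Summable (fun i => D.p i * globalBlock (D.Δ i) (D.spin i) z zb))
    (h₂ : Summable (fun i => D.p i * globalBlock (D.Δ i) (D.spin i) (1 - z) (1 - zb))) (o : Bool) :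
    Summable (fun i => D.p i * crossF s (-1) (orientedBlock (D.Δ i) (D.spin i) o) z zb) := by
  have hz' : 1 - z ∈ Ioo (0 : ℝ) 1 := ⟨by linarith [hz.2], by linarith [hz.1]⟩
  have hzb' : 1 - zb ∈ Ioo (0 : ℝ) 1 := ⟨by linarith [hzb.2], by linarith [hzb.1]⟩
  set V : ℝ := ((1 - z) * (1 - zb)) ^ s with hV
  set U : ℝ := (z * zb) ^ s with hUdef
  have hV0 : 0 ≤ V := Real.rpow_nonneg (mul_nonneg (by linarith [hz.2]) (by linarith [hzb.2])) s
  have hU0 : 0 ≤ U := Real.rpow_nonneg (mul_nonneg hz.1.le hzb.1.le) s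
  have hM : Summable (fun i => V * (D.p i * globalBlock (D.Δ i) (D.spin i) z zb) +
      U * (D.p i * globalBlock (D.Δ i) (D.spin i) (1 - z) (1 - zb))) :=
    (h₁.mul_left V).add (h₂.mul_left U)
  refine Summable.of_norm_bounded hM (fun i => ?_)
  obtain ⟨-, hΔ, hp⟩ := hU i
  have hb1 := orientedBlock_nonneg hΔ o hz hzb
  have hb2 := orientedBlock_nonneg hΔ o hz' hzb'
  have hg1 := orientedBlock_le_globalBlock hΔ o hz hzb
  have hg2 := orientedBlock_le_globalBlock hΔ o hz' hzb'
  rw [Real.norm_eq_abs, abs_mul, abs_of_nonneg hp]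
  have hrew : crossF s (-1) (orientedBlock (D.Δ i) (D.spin i) o) z zb =
      V * orientedBlock (D.Δ i) (D.spin i) o z zb - U * orientedBlock (D.Δ i) (D.spin i) o (1 - z) (1 - zb) := by
    simp only [crossF, hV, hUdef]; ring
  have hF : |crossF s (-1) (orientedBlock (D.Δ i) (D.spin i) o) z zb| ≤
      V * globalBlock (D.Δ i) (D.spin i) z zb + U * globalBlock (D.Δ i) (D.spin i) (1 - z) (1 - zb) := by
    rw [hrew]
    calc |V * orientedBlock (D.Δ i) (D.spin i) o z zb - U * orientedBlock (D.Δ i) (D.spin i) o (1 - z) (1 - zb)|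
        ≤ |V * orientedBlock (D.Δ i) (D.spin i) o z zb| +
            |U * orientedBlock (D.Δ i) (D.spin i) o (1 - z) (1 - zb)| := abs_sub _ _
      _ = V * orientedBlock (D.Δ i) (D.spin i) o z zb + U * orientedBlock (D.Δ i) (D.spin i) o (1 - z) (1 - zb) := by
          rw [abs_of_nonneg (mul_nonneg hV0 hb1), abs_of_nonneg (mul_nonneg hU0 hb2)]
      _ ≤ V * globalBlock (D.Δ i) (D.spin i) z zb + U * globalBlock (D.Δ i) (D.spin i) (1 - z) (1 - zb) :=
          add_le_add (mul_le_mul_of_nonneg_left hg1 hV0) (mul_le_mul_of_nonneg_left hg2 hU0)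
  calc D.p i * |crossF s (-1) (orientedBlock (D.Δ i) (D.spin i) o) z zb|
      ≤ D.p i * (V * globalBlock (D.Δ i) (D.spin i) z zb + U * globalBlock (D.Δ i) (D.spin i) (1 - z) (1 - zb)) :=
        mul_le_mul_of_nonneg_left hF hp
    _ = V * (D.p i * globalBlock (D.Δ i) (D.spin i) z zb) +
        U * (D.p i * globalBlock (D.Δ i) (D.spin i) (1 - z) (1 - zb)) := by ring

/-- **The doubling solves the oriented sum rule, GIVEN convergence of `Σ p g` on the open square.** Each
orientation is summable (`summable_oriented_of_convergent`); the two sums add up, termwise, to the typed family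
`p F_-[g]` (`F_-` of `g = b_true + b_false`), whose sum is `-F_-[1]` — so the oriented family over `ι ⊕ ι` has sum
`-F_-[1]` (`HasSum.sum`). The convergence hypothesis is genuinely needed to split a pair into its orientations; the
typed sum rule alone does not supply it. [cite: RattazziEtAl2008, §3 eq. (3.6)] -/
theorem double_satisfiesCrossing (hU : D.IsUnitary) (hC : D.SatisfiesCrossing s)
    (hconv : ∀ z zb : ℝ, z ∈ Ioo (0 : ℝ) 1 → zb ∈ Ioo (0 : ℝ) 1 →
      Summable (fun i => D.p i * globalBlock (D.Δ i) (D.spin i) z zb)) :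
    D.double.SatisfiesCrossing s := by
  intro z zb hz hzb
  have hz' : 1 - z ∈ Ioo (0 : ℝ) 1 := ⟨by linarith [hz.2], by linarith [hz.1]⟩
  have hzb' : 1 - zb ∈ Ioo (0 : ℝ) 1 := ⟨by linarith [hzb.2], by linarith [hzb.1]⟩
  have hT := (summable_oriented_of_convergent (s := s) hU hz hzb (hconv z zb hz hzb)
    (hconv _ _ hz' hzb') true).hasSum
  have hF := (summable_oriented_of_convergent (s := s) hU hz hzb (hconv z zb hz hzb)
    (hconv _ _ hz' hzb') false).hasSum
  -- the two orientations add up to the typed family, whose sum is `-F_-[1]`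
  have hsum : HasSum (fun i => D.p i * crossF s (-1) (globalBlock (D.Δ i) (D.spin i)) z zb)
      ((∑' i, D.p i * crossF s (-1) (orientedBlock (D.Δ i) (D.spin i) true) z zb) +
        ∑' i, D.p i * crossF s (-1) (orientedBlock (D.Δ i) (D.spin i) false) z zb) := by
    refine (hT.add hF).congr_fun fun i => ?_
    rw [globalBlock_eq_orientedBlock_add (D.Δ i) (D.spin i), crossF_add_apply]
    ring
  have hab := hsum.unique (hC z zb hz hzb)
  -- assemble over `ι ⊕ ι`
  have hA : HasSum ((fun j : D.double.ι => D.double.p j *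
      crossF s (-1) (orientedBlock (D.double.Δ j) (D.double.spin j) (D.double.orient j)) z zb) ∘ Sum.inl)
      (∑' i, D.p i * crossF s (-1) (orientedBlock (D.Δ i) (D.spin i) true) z zb) :=
    hT.congr_fun fun i => rfl
  have hB : HasSum ((fun j : D.double.ι => D.double.p j *
      crossF s (-1) (orientedBlock (D.double.Δ j) (D.double.spin j) (D.double.orient j)) z zb) ∘ Sum.inr)
      (∑' i, D.p i * crossF s (-1) (orientedBlock (D.Δ i) (D.spin i) false) z zb) :=
    hF.congr_fun fun i => rfl
  have hAB := HasSum.sum hA hB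
  rw [hab] at hAB
  exact hAB

end CrossingData

/-! ### The oriented `A2D′` class at the control column is inhabited: the 2D Ising datum -/

/-- The 2D Ising datum's block expansion converges on the open square (`hasSum_isingData2D_blocks`).
[cite: BelavinPolyakovZamolodchikov1984, App. E] -/
theorem isingData2D_blocks_summable {z zb : ℝ} (hz : z ∈ Ioo (0 : ℝ) 1) (hzb : zb ∈ Ioo (0 : ℝ) 1) :
    Summable (fun i => isingData2D.p i * globalBlock (isingData2D.Δ i) (isingData2D.spin i) z zb) :=
  (hasSum_isingData2D_blocks hz hzb).summable

/-- **The 2D Ising datum as oriented data** (each quasi-primary pair listed in both orientations; `T` and `T̄`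
are the two orientations of the typed stress-tensor label). [cite: BelavinPolyakovZamolodchikov1984, App. E] -/
noncomputable def isingOriented : OrientedData := isingData2D.double

/-- The oriented Ising datum is unitary, solves the ORIENTED sum rule at `Δ_σ = 1/8`, and sits in the `A2D′`
`(G, δ) = (2, 1)` class at location `x = 1`: scalars in `{1} ∪ [2, ∞)`, spin 2 in `{2} ∪ [3, ∞)`.
[cite: BelavinPolyakovZamolodchikov1984, App. E] -/
theorem isingOriented_A2D :
    isingOriented.IsUnitary ∧ isingOriented.SatisfiesCrossing (1 / 8) ∧
      isingOriented.toCrossingData.ScalarsIn ({1} ∪ Ici 2) ∧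
        isingOriented.toCrossingData.SpinTwoIn ({2} ∪ Ici (2 + 1)) := by
  have hS : isingData2D.ScalarsIn ({1} ∪ Ici 2) :=
    isingData2D_scalarsIn.mono (union_subset_union le_rfl (Ici_subset_Ici.mpr (by norm_num)))
  have hT : isingData2D.SpinTwoIn ({2} ∪ Ici (2 + 1)) := by
    rw [show (2 : ℝ) + 1 = 3 by norm_num]; exact isingData2D_spinTwoIn
  obtain ⟨hS', hT'⟩ := CrossingData.double_clauses hS hT
  exact ⟨CrossingData.double_isUnitary isingData2D_isUnitary,
    CrossingData.double_satisfiesCrossing isingData2D_isUnitary isingData2D_satisfiesCrossing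
      (fun _ _ hz hzb => isingData2D_blocks_summable hz hzb), hS', hT'⟩

/-- **`T` and `T̄` as two oriented labels with the Ward coefficient each**: the oriented Ising datum has a label
`(Δ, ℓ) = (2, 2)` of orientation `true` (`(h, h̄) = (2, 0)`, block `k_4(z)`) and one of orientation `false`
(`(0, 2)`, block `k_4(z̄)`), each with `p = 1/64 = (1/8)²/(2·½)` — the Belavin–Polyakov–Zamolodchikov value at
`c_L = c_R = 1/2`. [cite: BelavinPolyakovZamolodchikov1984, §3] -/
theorem isingOriented_stressLabels :
    (isingOriented.Δ (Sum.inl (Sum.inl isingStressLabel)) = 2 ∧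
      isingOriented.spin (Sum.inl (Sum.inl isingStressLabel)) = 2 ∧
        isingOriented.orient (Sum.inl (Sum.inl isingStressLabel)) = true ∧
          isingOriented.p (Sum.inl (Sum.inl isingStressLabel)) = (1 / 8 : ℝ) ^ 2 / (2 * (1 / 2))) ∧
    (isingOriented.Δ (Sum.inr (Sum.inl isingStressLabel)) = 2 ∧
      isingOriented.spin (Sum.inr (Sum.inl isingStressLabel)) = 2 ∧
        isingOriented.orient (Sum.inr (Sum.inl isingStressLabel)) = false ∧
          isingOriented.p (Sum.inr (Sum.inl isingStressLabel)) = (1 / 8 : ℝ) ^ 2 / (2 * (1 / 2))) := by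
  obtain ⟨h1, h2, h3⟩ := isingData2D_stressLabel
  have h64 : (1 / 8 : ℝ) ^ 2 / (2 * (1 / 2)) = 1 / 64 := by norm_num
  rw [h64]
  exact ⟨⟨h1, h2, rfl, h3⟩, ⟨h1, h2, rfl, h3⟩⟩

/-- **The convention, pinned on the 2D Ising datum** (review ask of the cell lead): read without the parity
convention, ⟨σσσσ⟩ of the 2D Ising CFT has ORIENTED total `(2,2)` coefficient `1/32 = p_T + p_T̄ = 2 · (1/8)²/(2·½)`
and ORIENTED in-box total `1/4 = λ²_{σσε}` on the record's `ε` box `[99/100, 20001/20000]` (standard normalisation);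
its symmetrisation returns the typed values `p_T = 1/64` (`isingData2D_stressCoeff`) and `p_ε = 1/8 = λ²_{σσε}/2`
(`isingData2D_boxCoeff`). [cite: BelavinPolyakovZamolodchikov1984, §3] -/
theorem isingOriented_totals :
    isingOriented.toCrossingData.stressCoeff = 1 / 32 ∧ isingOriented.symm.stressCoeff = 1 / 64 ∧
      isingOriented.toCrossingData.boxCoeff (99 / 100) (20001 / 20000) = 1 / 4 ∧
        isingOriented.symm.boxCoeff (99 / 100) (20001 / 20000) = 1 / 8 := by
  have hS : Summable (isingData2D.stressSet.indicator isingData2D.p) :=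
    (hasSum_single _ isingData2D_stress_indicator_of_ne).summable
  have hB : Summable ((isingData2D.boxSet (99 / 100) (20001 / 20000)).indicator isingData2D.p) :=
    (hasSum_single _ (isingData2D_box_indicator_of_ne (by norm_num : (20001 / 20000 : ℝ) < 4))).summable
  have hbox : isingData2D.boxCoeff (99 / 100) (20001 / 20000) = 1 / 8 :=
    isingData2D_boxCoeff (by norm_num) (by norm_num) (by norm_num)
  refine ⟨?_, ?_, ?_, ?_⟩
  · show isingData2D.double.toCrossingData.stressCoeff = 1 / 32
    rw [CrossingData.double_stressCoeff hS, isingData2D_stressCoeff]; norm_num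
  · show isingData2D.double.symm.stressCoeff = 1 / 64
    rw [CrossingData.double_symm_stressCoeff hS, isingData2D_stressCoeff]
  · show isingData2D.double.toCrossingData.boxCoeff (99 / 100) (20001 / 20000) = 1 / 4
    rw [CrossingData.double_boxCoeff hB, hbox]; norm_num
  · show isingData2D.double.symm.boxCoeff (99 / 100) (20001 / 20000) = 1 / 8
    rw [CrossingData.double_symm_boxCoeff hB, hbox]

/-- **The oriented `A2D′` class at the control column is inhabited** — by ⟨σσσσ⟩ of the 2D Ising CFT read
without the parity convention — so every oriented exclusion removes something from a non-empty class, and the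
location `x = 1` is admissible for oriented data too: the `Λ = 19` oriented window `(0.99, 1.00005)` is pinned
around an attained value. [cite: BelavinPolyakovZamolodchikov1984, App. E] -/
theorem oriented_class_nonvacuous_eighth :
    (∃ D : OrientedData, D.IsUnitary ∧ D.SatisfiesCrossing (1 / 8) ∧
      D.toCrossingData.ScalarsIn ({1} ∪ Ici 2) ∧ D.toCrossingData.SpinTwoIn ({2} ∪ Ici (2 + 1))) ∧
    ¬ (∀ D : OrientedData, D.IsUnitary → D.SatisfiesCrossing (1 / 8) →
        D.toCrossingData.ScalarsIn ({1} ∪ Ici 2) → D.toCrossingData.SpinTwoIn ({2} ∪ Ici (2 + 1)) → False) := by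
  obtain ⟨hU, hC, hS, hT⟩ := isingOriented_A2D
  exact ⟨⟨isingOriented, hU, hC, hS, hT⟩, fun h => h isingOriented hU hC hS hT⟩

end Summit.CriticalPhenomena.Ising3D.Control2D
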